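import Summits.ValiantsHypothesis.ValiantsHypothesis.Theorems.KPlusLogSqLawTropicalBUpperBand

/-!
# Route «KPlusLogSqLaw», crux `TropicalB` (stmt-ValiantsHypothesis-19771) — CROSSING-BOUNDED CHAINS ARE SHORT IN EVERY DESIGN:
# a dominant chain whose terms cross every column cut at most `w` times has `n ≤ 2^{(20w+8)(K + ⌊log₂ m⌋²)}`

HONEST FRAMING.  Helper toward the registered stubs `stub_tropThin` / `stub_tropFat` of `Cruxes/TropicalB/Lines/birth.lean` (crux
`Summit.ValiantsHypothesis.ValiantsHypothesis.Theses.KPlusLogSqLaw.TropicalB`, item stmt-ValiantsHypothesis-19771, route KPlusLogSqLaw,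
DRAFT; cell `pub-symmetroid`, seat val-sym-trop-p1 g7, 2026-08-27; `--supports … --as helper`).  A STRUCTURE theorem about dominant
chains of ARBITRARY designs (dense supports included) plus one new support sector; it does NOT bound `TropicalB` for general chains, and
nothing here bears on `TropicalB` in its window, `WeakLifting`, DoorA26 / DoorA34, `MatrixDescartes` (stmt-ValiantsHypothesis-18050) or
VP ≠ VNP.

THE POINT.  The bounded up-jump sector theorem (`IntervalOpt.designRowD_upperBand`, seat val-sym-trop-p5: supports with `a ≤ b + u` obey
`n ≤ 2^{(20u+8)(K + ⌊log₂ m⌋²)}`) is proved by Gusfield's recursion over (column interval, row image) pairs, the support hypothesis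
entering only through the number of SHAPES the image `σ([a, t))` of a column interval can take.  That number is controlled by the
CROSSING NUMBERS of the permutation alone (`#{i < t ≤ σ i}` at each cut `t`; the down-crossings `#{σ i < t ≤ i}` are equal by the
balance `card_cross_down_eq_card_cross_up`), and the recursion (`card_optRestr_union_le`, `chain_le_card_optRestr`) only ever
restricts the CHAIN'S OWN terms — other terms enter through presence alone.  Hence the bound is a property of the chain's permutations:

* `image_mem_shapes_of_cross` — a permutation with up-crossings `≤ w` at every cut sends `[a, t)` onto a member of `shapes m w a t`;
* `card_optRestr_img_le_of_states_pred`, `chain_le_of_states_pred` — the state-count meta-theorem of `…TropicalBUpperBand` carried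
  with an arbitrary per-term predicate `P` (only terms satisfying `P` are restricted; `P` rides along the recursion);
* `chain_le_of_crossings` — **in ANY design, a dominant chain with distinct consecutive terms all of whose terms have up-crossings
  `≤ w` at every column cut has `n + 1 ≤ (mK+1)·(2((2w+1)(m+1)^{2w})²)^{⌊log₂ m⌋+1}`**, and `crossing_chain_le_two_pow`:
  `n ≤ 2^{(20w+8)(K + ⌊log₂ m⌋²)}` (the arithmetic `upperBand_size_le_two_pow` reused verbatim); signed crux-currency form
  `tropicalB_crossing`;
* `exists_crossing_of_long_chain` — contrapositive for the construction side: a chain with `n > 2^{(20w+8)(K + ⌊log₂ m⌋²)}` contains a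
  term crossing some column cut at least `w + 1` times (in the given orders; by the tree's relabelling invariance the same holds after any
  reordering of rows and of columns, so a counterexample chain to the `K + log² m` law is an «expander» for every pair of orders);
* `cross_le_of_upJump` — up-jumps `≤ u` give crossings `≤ u`, so `designRowD_upperBand` (…TropicalBUpperBand) is the special case
  `w = u` of `crossing_chain_le_two_pow` (not restated here);
* `cross_le_of_upJump_off`, `designRowD_upJumpOff`, `tropicalB_upJumpOff` — NEW SUPPORT SECTOR: if every present entry `(a, b)`
  satisfies `a ≤ b + u` OR lies in one of the rows of `A` OR in one of the columns of `B`, every present term has up-crossings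
  `≤ u + #A + #B`, so the design obeys `n ≤ 2^{(20(u + #A + #B)+8)(K + ⌊log₂ m⌋²)}`: «banded plus `O(1)` arbitrary dense rows and
  columns» is inside `TropicalB` with an absolute constant, all formats, window included.

[folklore] D. Gusfield, Sensitivity analysis for combinatorial optimization, PhD thesis, UC Berkeley (1980); the crossing-number state
count is the standard width argument.  Tree inputs: `IntervalOpt.shapes`, `card_shapes_le`, `one_le_card_shapes`,
`card_cross_down_eq_card_cross_up`, `card_cross_up_le`, `row_le_add_of_present` (…UpperBandTypes); `card_optRestr_union_le`,
`chain_le_card_optRestr`, `card_optRestr_le_of_card_le_one`, `image_eq_sdiff_of_union`, `disjoint_ico_ico`, `upperBand_size_le_two_pow`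
(…UpperBand / …IntervalOpt / …HessenbergBlocks); `injective_of_chainD`, `ne_succ_of_alternating`, `tropRowD_zero` (…SplitDefs).
-/

set_option linter.dupNamespace false
set_option autoImplicit false

namespace Summit.ValiantsHypothesis.ValiantsHypothesis.Theorems.KPlusLogSqLaw

open Summit.ValiantsHypothesis.ValiantsHypothesis.Theorems.MatrixDescartes.Negative
open Summit.ValiantsHypothesis.ValiantsHypothesis.Theorems.LacunarySymmetroidMatrixDescartes
open scoped BigOperators
open Finset

namespace IntervalOpt

variable {m K : ℕ} {d : Fin K → ℕ} {v ε : Fin m → Fin m → Fin K → ℤ}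

/-! ## 1. Shapes from crossing numbers alone -/

/-- **The image of a column interval is a shape, crossing form.**  If the permutation `σ` has at most `w` up-crossings
`#{i < t ≤ σ i}` at every cut `t`, then `σ([a, t)) ∈ shapes m w a t` (it differs from `[a, t)` by `≤ 2w` removed and `≤ 2w` added
rows).  Same proof as `image_mem_shapes`, the down-crossings at `a` being bounded by balance. [folklore] -/
theorem image_mem_shapes_of_cross {w : ℕ} {σ : Equiv.Perm (Fin m)}
    (hcross : ∀ t : ℕ, (Finset.univ.filter fun i : Fin m => (i : ℕ) < t ∧ t ≤ ((σ i : Fin m) : ℕ)).card ≤ w)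
    (a t : ℕ) : (ico m a t).image σ ∈ shapes m w a t := by
  classical
  set J := ico m a t with hJ
  set R := J.image σ with hR
  have hdown : (Finset.univ.filter fun i : Fin m => a ≤ (i : ℕ) ∧ ((σ i : Fin m) : ℕ) < a).card ≤ w := by
    rw [card_cross_down_eq_card_cross_up]; exact hcross a
  -- `W = R \ J`: rows outside `[a,t)` hit from `[a,t)` — above `t` from up-crossing columns, below `a` from down-crossing columns
  have hW : (R \ J).card ≤ 2 * w := by
    have hsplit : R \ J ⊆ ((Finset.univ.filter fun i : Fin m => (i : ℕ) < t ∧ t ≤ ((σ i : Fin m) : ℕ)).image σ) ∪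
        ((Finset.univ.filter fun i : Fin m => a ≤ (i : ℕ) ∧ ((σ i : Fin m) : ℕ) < a).image σ) := by
      intro r hr
      rw [Finset.mem_sdiff] at hr
      obtain ⟨i, hi, rfl⟩ := Finset.mem_image.1 hr.1
      rw [hJ, mem_ico] at hi
      have hni : ¬ (a ≤ ((σ i : Fin m) : ℕ) ∧ ((σ i : Fin m) : ℕ) < t) := fun h => hr.2 (by rw [hJ, mem_ico]; exact h)
      rw [Finset.mem_union, Finset.mem_image, Finset.mem_image]
      rcases Nat.lt_or_ge ((σ i : Fin m) : ℕ) a with hlt | hge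
      · exact Or.inr ⟨i, by rw [Finset.mem_filter]; exact ⟨Finset.mem_univ _, hi.1, hlt⟩, rfl⟩
      · exact Or.inl ⟨i, by rw [Finset.mem_filter]; exact ⟨Finset.mem_univ _, hi.2, by omega⟩, rfl⟩
    calc (R \ J).card ≤ _ := Finset.card_le_card hsplit
      _ ≤ _ := Finset.card_union_le _ _
      _ ≤ w + w := Nat.add_le_add (Finset.card_image_le.trans (hcross t)) (Finset.card_image_le.trans hdown)
      _ = 2 * w := by ring
  -- `X = J \ R` has the same size as `R \ J`
  have hX : (J \ R).card ≤ 2 * w := by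
    have hc : R.card = J.card := Finset.card_image_of_injective _ σ.injective
    have e1 := Finset.card_sdiff_add_card_inter R J
    have e2 := Finset.card_sdiff_add_card_inter J R
    rw [Finset.inter_comm] at e2
    omega
  unfold shapes
  refine Finset.mem_image.2 ⟨(J \ R, R \ J), ?_, ?_⟩
  · rw [Finset.mem_product, Finset.mem_filter, Finset.mem_filter, Finset.mem_powerset, Finset.mem_powerset]
    exact ⟨⟨Finset.sdiff_subset, hX⟩, Finset.sdiff_subset_sdiff (Finset.subset_univ _) (le_refl _), hW⟩
  · ext r
    simp only [Finset.mem_union, Finset.mem_sdiff]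
    tauto

/-! ## 2. The state-count recursion carried with a per-term predicate -/

/-- **State-count recursion with a predicate.**  Let `P` be any predicate on Leibniz terms and `St a t` finite families of row
sets of size `≤ T` (`T ≥ 1`) such that every PRESENT term SATISFYING `P` sends the column interval `[a, t)` onto a member of
`St a t`.  Then a column interval of length `≤ 2^k` has at most `(mK+1)·(2T)^k` optimal restrictions of `P`-terms with any prescribed
image `R`.  (The proof of `card_optRestr_img_le_of_states` verbatim: the recursion only restricts the term itself, so `P` rides
along; non-`P` terms enter through presence only, inside `card_optRestr_union_le`.) [folklore] -/
theorem card_optRestr_img_le_of_states_pred (P : Equiv.Perm (Fin m) × (Fin m → Fin K) → Prop)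
    (St : ℕ → ℕ → Finset (Finset (Fin m))) (T : ℕ) (hT1 : 1 ≤ T)
    (hT : ∀ a t : ℕ, (St a t).card ≤ T)
    (hSt : ∀ p : Equiv.Perm (Fin m) × (Fin m → Fin K), termSign ε p ≠ 0 → P p → ∀ a t : ℕ, (ico m a t).image p.1 ∈ St a t) :
    ∀ (k a c : ℕ) (R : Finset (Fin m)), a ≤ c → c - a ≤ 2 ^ k →
      (optRestr d v ε (ico m a c) (fun p => (ico m a c).image p.1 = R ∧ P p)).card ≤ (m * K + 1) * (2 * T) ^ k := by
  classical
  intro k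
  induction k with
  | zero =>
    intro a c R _ hl
    have hJ : (ico m a c).card ≤ 1 := (card_ico_le a c).trans (by simpa using hl)
    calc _ ≤ m * K + 1 := card_optRestr_le_of_card_le_one hJ _
      _ = (m * K + 1) * (2 * T) ^ 0 := by simp
  | succ k ih =>
    intro a c R hac hl
    by_cases hsmall : c - a ≤ 2 ^ k
    · calc _ ≤ (m * K + 1) * (2 * T) ^ k := ih a c R hac hsmall
        _ ≤ (m * K + 1) * (2 * T) ^ (k + 1) :=
            Nat.mul_le_mul_left _ (Nat.pow_le_pow_right (by omega) (Nat.le_succ _))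
    · -- split at `t = a + 2^k`
      set t := a + 2 ^ k with ht
      have hat : a ≤ t := by omega
      have htc : t ≤ c := by
        have : 2 ^ (k + 1) = 2 ^ k + 2 ^ k := by rw [pow_succ]; ring
        omega
      have hl1 : t - a ≤ 2 ^ k := by omega
      have hl2 : c - t ≤ 2 ^ k := by
        have : 2 ^ (k + 1) = 2 ^ k + 2 ^ k := by rw [pow_succ]; ring
        omega
      have hsplit : ico m a c = ico m a t ∪ ico m t c := ico_union hat htc
      -- (i) cover by the state of the first half
      have hcover : optRestr d v ε (ico m a c) (fun p => (ico m a c).image p.1 = R ∧ P p) ⊆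
          (St a t).biUnion fun S => optRestr d v ε (ico m a c)
            (fun p => ((ico m a c).image p.1 = R ∧ P p) ∧ (ico m a t).image p.1 = S) := by
        intro r hr
        obtain ⟨p, θ, hq, hopt, rfl⟩ := mem_optRestr.1 hr
        exact Finset.mem_biUnion.2 ⟨(ico m a t).image p.1, hSt p hopt.1 hq.2 a t,
          mem_optRestr.2 ⟨p, θ, ⟨hq, rfl⟩, hopt, rfl⟩⟩
      -- (ii) each group by sub-additivity and the induction hypothesis
      have hgroup : ∀ S ∈ St a t, (optRestr d v ε (ico m a c)
          (fun p => ((ico m a c).image p.1 = R ∧ P p) ∧ (ico m a t).image p.1 = S)).card ≤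
            (m * K + 1) * (2 * T) ^ k + (m * K + 1) * (2 * T) ^ k := by
        intro S _
        rw [hsplit]
        have step := card_optRestr_union_le (d := d) (v := v) (ε := ε) (J₁ := ico m a t) (J₂ := ico m t c)
          (Q := fun p => ((ico m a t ∪ ico m t c).image p.1 = R ∧ P p) ∧ (ico m a t).image p.1 = S)
          (Q₁ := fun p => (ico m a t).image p.1 = S ∧ P p)
          (Q₂ := fun p => (ico m t c).image p.1 = R \ S ∧ P p)
          (fun p h => ⟨h.2, h.1.2⟩)
          (fun p h => ⟨by rw [image_eq_sdiff_of_union (disjoint_ico_ico a t c) p.1, h.1.1, h.2], h.1.2⟩)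
          (fun p p' h h' => by rw [h.1, h'.1])
          (fun p p' h h' => by rw [h.1, h'.1])
        exact step.trans (Nat.add_le_add (ih a t S hat hl1) (ih t c (R \ S) htc hl2))
      -- (iii) sum over the states
      calc _ ≤ ((St a t).biUnion fun S => optRestr d v ε (ico m a c)
              (fun p => ((ico m a c).image p.1 = R ∧ P p) ∧ (ico m a t).image p.1 = S)).card :=
            Finset.card_le_card hcover
        _ ≤ ∑ S ∈ St a t, (optRestr d v ε (ico m a c)
              (fun p => ((ico m a c).image p.1 = R ∧ P p) ∧ (ico m a t).image p.1 = S)).card := Finset.card_biUnion_le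
        _ ≤ ∑ _S ∈ St a t, ((m * K + 1) * (2 * T) ^ k + (m * K + 1) * (2 * T) ^ k) :=
            Finset.sum_le_sum hgroup
        _ = (St a t).card * (2 * ((m * K + 1) * (2 * T) ^ k)) := by
            rw [Finset.sum_const, smul_eq_mul]; ring
        _ ≤ T * (2 * ((m * K + 1) * (2 * T) ^ k)) := Nat.mul_le_mul_right _ (hT a t)
        _ = (m * K + 1) * (2 * T) ^ (k + 1) := by rw [pow_succ]; ring

/-- **chain form with a predicate**: if every term of a dominant chain (distinct consecutive terms) satisfies `P`, and present
`P`-terms send column intervals onto `≤ T` row sets, then `n + 1 ≤ (mK+1)·(2T)^{⌊log₂ m⌋+1}`. [folklore] -/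
theorem chain_le_of_states_pred (P : Equiv.Perm (Fin m) × (Fin m → Fin K) → Prop)
    (St : ℕ → ℕ → Finset (Finset (Fin m))) (T : ℕ) (hT1 : 1 ≤ T)
    (hT : ∀ a t : ℕ, (St a t).card ≤ T)
    (hSt : ∀ p : Equiv.Perm (Fin m) × (Fin m → Fin K), termSign ε p ≠ 0 → P p → ∀ a t : ℕ, (ico m a t).image p.1 ∈ St a t)
    {n : ℕ} (θ : Fin (n + 1) → ℤ) (p : Fin (n + 1) → Equiv.Perm (Fin m) × (Fin m → Fin K)) (hθ : StrictMono θ)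
    (hdom : ∀ k, IsDominant d v ε (θ k) (p k)) (hne : ∀ k : Fin n, p k.castSucc ≠ p k.succ) (hP : ∀ k, P (p k)) :
    n + 1 ≤ (m * K + 1) * (2 * T) ^ (Nat.log 2 m + 1) := by
  classical
  have hinj := injective_of_chainD d v ε θ p hθ hdom hne
  have h1 := chain_le_card_optRestr (d := d) (v := v) (ε := ε) θ p hinj hdom
    (fun q => (ico m 0 m).image q.1 = ico m 0 m ∧ P q)
    (fun k => ⟨by rw [ico_univ]; exact Finset.image_univ_equiv _, hP k⟩)
  rw [← (ico_univ : ico m 0 m = Finset.univ)] at h1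
  have h2 := card_optRestr_img_le_of_states_pred (d := d) (v := v) P St T hT1 hT hSt (Nat.log 2 m + 1) 0 m (ico m 0 m)
    (Nat.zero_le _) (by have := Nat.lt_pow_succ_log_self one_lt_two m; omega)
  exact h1.trans h2

/-! ## 3. Crossing-bounded chains in an arbitrary design -/

/-- **CROSSING-BOUNDED CHAINS ARE SHORT (polynomial-state form).**  In ANY design of format `(m, K)`, a dominant chain with
distinct consecutive terms each of whose permutations has at most `w` up-crossings `#{i < t ≤ σ i}` at every column cut `t` has
`n + 1 ≤ (mK+1)·(2((2w+1)(m+1)^{2w})²)^{⌊log₂ m⌋+1}` terms.  No hypothesis on the support. [folklore: Gusfield 1980] -/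
theorem chain_le_of_crossings {w n : ℕ} (θ : Fin (n + 1) → ℤ) (p : Fin (n + 1) → Equiv.Perm (Fin m) × (Fin m → Fin K))
    (hθ : StrictMono θ) (hdom : ∀ k, IsDominant d v ε (θ k) (p k)) (hne : ∀ k : Fin n, p k.castSucc ≠ p k.succ)
    (hcross : ∀ (k : Fin (n + 1)) (t : ℕ),
      (Finset.univ.filter fun i : Fin m => (i : ℕ) < t ∧ t ≤ (((p k).1 i : Fin m) : ℕ)).card ≤ w) :
    n + 1 ≤ (m * K + 1) * (2 * ((2 * w + 1) * (m + 1) ^ (2 * w)) ^ 2) ^ (Nat.log 2 m + 1) :=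
  chain_le_of_states_pred (d := d) (v := v) (ε := ε)
    (fun q => ∀ t : ℕ, (Finset.univ.filter fun i : Fin m => (i : ℕ) < t ∧ t ≤ ((q.1 i : Fin m) : ℕ)).card ≤ w)
    (shapes m w) _ ((one_le_card_shapes (m := m) w 0 0).trans (card_shapes_le w 0 0)) (fun a t => card_shapes_le w a t)
    (fun _ _ hq a t => image_mem_shapes_of_cross hq a t) θ p hθ hdom hne hcross

/-- **CROSSING-BOUNDED CHAINS ARE SHORT.**  In ANY design of format `(m, K)`, a dominant chain (unique optima at strictly
increasing integer slopes, distinct consecutive terms) all of whose terms cross every column cut at most `w` times satisfies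
`n ≤ 2^{(20w+8)(K + ⌊log₂ m⌋²)}` — the conclusion of `TropicalB` with `C = 20w + 8`, as a property of the CHAIN.
[folklore: Gusfield 1980] -/
theorem crossing_chain_le_two_pow (w : ℕ) (d : Fin K → ℕ) (v ε : Fin m → Fin m → Fin K → ℤ) {n : ℕ}
    (θ : Fin (n + 1) → ℤ) (p : Fin (n + 1) → Equiv.Perm (Fin m) × (Fin m → Fin K))
    (hθ : StrictMono θ) (hdom : ∀ k, IsDominant d v ε (θ k) (p k)) (hne : ∀ k : Fin n, p k.castSucc ≠ p k.succ)
    (hcross : ∀ (k : Fin (n + 1)) (t : ℕ),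
      (Finset.univ.filter fun i : Fin m => (i : ℕ) < t ∧ t ≤ (((p k).1 i : Fin m) : ℕ)).card ≤ w) :
    n ≤ 2 ^ ((20 * w + 8) * (K + Nat.log 2 m ^ 2)) := by
  rcases Nat.eq_zero_or_pos K with hK | hK
  · subst hK
    exact (tropRowD_zero m 0 d v ε n θ p hθ hdom hne).trans (Nat.zero_le _)
  · have h1 := chain_le_of_crossings (d := d) (v := v) (ε := ε) θ p hθ hdom hne hcross
    have h2 := upperBand_size_le_two_pow m K w hK
    omega

/-- **Contrapositive (construction side): long chains cross.**  In any design, a dominant chain with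
`n > 2^{(20w+8)(K + ⌊log₂ m⌋²)}` contains a term whose permutation crosses some column cut at least `w + 1` times.  (By the
tree's relabelling invariance of chains this holds after ANY reordering of rows and of columns: a counterexample chain to the
`K + log² m` law is badly crossing for every pair of orders.) [folklore] -/
theorem exists_crossing_of_long_chain (w : ℕ) (d : Fin K → ℕ) (v ε : Fin m → Fin m → Fin K → ℤ) {n : ℕ}
    (θ : Fin (n + 1) → ℤ) (p : Fin (n + 1) → Equiv.Perm (Fin m) × (Fin m → Fin K))
    (hθ : StrictMono θ) (hdom : ∀ k, IsDominant d v ε (θ k) (p k)) (hne : ∀ k : Fin n, p k.castSucc ≠ p k.succ)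
    (hn : 2 ^ ((20 * w + 8) * (K + Nat.log 2 m ^ 2)) < n) :
    ∃ (k : Fin (n + 1)) (t : ℕ),
      w < (Finset.univ.filter fun i : Fin m => (i : ℕ) < t ∧ t ≤ (((p k).1 i : Fin m) : ℕ)).card := by
  by_contra h
  push Not at h
  exact absurd (crossing_chain_le_two_pow w d v ε θ p hθ hdom hne h) (not_le.mpr hn)

/-! ## 4. The up-jump sector as the special case `w = u`, and the sector «up-jump except in a few dense rows and columns» -/

/-- with up-jumps `≤ u` every present term has up-crossings `≤ u` at every cut (`card_cross_up_le`); fed into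
`crossing_chain_le_two_pow` this is exactly the landed `designRowD_upperBand` (…TropicalBUpperBand), not restated here. [folklore] -/
theorem cross_le_of_upJump {u : ℕ} (hU : ∀ (a b : Fin m) (l : Fin K), ε a b l ≠ 0 → (a : ℕ) ≤ (b : ℕ) + u)
    {p : Equiv.Perm (Fin m) × (Fin m → Fin K)} (hp : termSign ε p ≠ 0) (t : ℕ) :
    (Finset.univ.filter fun i : Fin m => (i : ℕ) < t ∧ t ≤ ((p.1 i : Fin m) : ℕ)).card ≤ u :=
  card_cross_up_le (row_le_add_of_present hU hp) t

/-- **crossings of the exceptional sector.**  If every present entry `(a, b)` satisfies `a ≤ b + u` or `a ∈ A` or `b ∈ B`, then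
every present term has at most `u + #A + #B` up-crossings at every cut: a crossing column `i` (`i < t ≤ σ i`) is either within
`u` of the cut, or sent into a row of `A` (injectively), or a column of `B`. [folklore] -/
theorem cross_le_of_upJump_off {u : ℕ} {A B : Finset (Fin m)}
    (hU : ∀ (a b : Fin m) (l : Fin K), ε a b l ≠ 0 → (a : ℕ) ≤ (b : ℕ) + u ∨ a ∈ A ∨ b ∈ B)
    {p : Equiv.Perm (Fin m) × (Fin m → Fin K)} (hp : termSign ε p ≠ 0) (t : ℕ) :
    (Finset.univ.filter fun i : Fin m => (i : ℕ) < t ∧ t ≤ ((p.1 i : Fin m) : ℕ)).card ≤ u + A.card + B.card := by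
  classical
  set S := Finset.univ.filter fun i : Fin m => (i : ℕ) < t ∧ t ≤ ((p.1 i : Fin m) : ℕ) with hS
  have hpres := (termSign_ne_zero_iff ε p).1 hp
  -- the three parts
  set S₁ := S.filter fun i : Fin m => ((p.1 i : Fin m) : ℕ) ≤ (i : ℕ) + u with hS₁
  set S₂ := S.filter fun i : Fin m => p.1 i ∈ A with hS₂
  set S₃ := S.filter fun i : Fin m => i ∈ B with hS₃
  have hcov : S ⊆ S₁ ∪ S₂ ∪ S₃ := by
    intro i hi
    rcases hU (p.1 i) i (p.2 i) (hpres i) with h | h | h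
    · exact Finset.mem_union_left _ (Finset.mem_union_left _ (Finset.mem_filter.2 ⟨hi, h⟩))
    · exact Finset.mem_union_left _ (Finset.mem_union_right _ (Finset.mem_filter.2 ⟨hi, h⟩))
    · exact Finset.mem_union_right _ (Finset.mem_filter.2 ⟨hi, h⟩)
  have h1 : S₁.card ≤ u := by
    have hsub : S₁ ⊆ ico m (t - u) t := by
      intro i hi
      rw [hS₁, Finset.mem_filter, hS, Finset.mem_filter] at hi
      rw [mem_ico]
      omega
    calc S₁.card ≤ (ico m (t - u) t).card := Finset.card_le_card hsub
      _ ≤ t - (t - u) := card_ico_le _ _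
      _ ≤ u := by omega
  have h2 : S₂.card ≤ A.card := by
    calc S₂.card = (S₂.image p.1).card := (Finset.card_image_of_injective _ p.1.injective).symm
      _ ≤ A.card := Finset.card_le_card fun r hr => by
          obtain ⟨i, hi, rfl⟩ := Finset.mem_image.1 hr
          exact (Finset.mem_filter.1 hi).2
  have h3 : S₃.card ≤ B.card := Finset.card_le_card fun i hi => (Finset.mem_filter.1 hi).2
  calc S.card ≤ (S₁ ∪ S₂ ∪ S₃).card := Finset.card_le_card hcov
    _ ≤ (S₁ ∪ S₂).card + S₃.card := Finset.card_union_le _ _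
    _ ≤ S₁.card + S₂.card + S₃.card := Nat.add_le_add_right (Finset.card_union_le _ _) _
    _ ≤ u + A.card + B.card := by omega

/-- **NEW SUPPORT SECTOR: up-jump `≤ u` except inside the rows of `A` and the columns of `B`.**  Such a design has unsigned row
bound `2^{(20(u + #A + #B)+8)(K + ⌊log₂ m⌋²)}` — e.g. a Hessenberg design with `O(1)` extra arbitrary dense rows and columns obeys
the `K + log² m` law with an absolute constant, in the window included. [folklore] -/
theorem designRowD_upJumpOff (u : ℕ) (A B : Finset (Fin m)) (d : Fin K → ℕ) (v ε : Fin m → Fin m → Fin K → ℤ)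
    (hU : ∀ (a b : Fin m) (l : Fin K), ε a b l ≠ 0 → (a : ℕ) ≤ (b : ℕ) + u ∨ a ∈ A ∨ b ∈ B) :
    DesignRowD d v ε (2 ^ ((20 * (u + A.card + B.card) + 8) * (K + Nat.log 2 m ^ 2))) :=
  fun _ θ p hθ hdom hne =>
    crossing_chain_le_two_pow (u + A.card + B.card) d v ε θ p hθ hdom hne
      fun k t => cross_le_of_upJump_off hU (hdom k).1 t

end IntervalOpt

open IntervalOpt in
/-- **CROSSING-BOUNDED CHAINS ARE SHORT (crux currency).**  For every `w` there is `C` (`= 20w + 8`) such that for ALL `m, K` and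
EVERY tropical design of format `(m, K)` — no support hypothesis — a sign-alternating chain of dominant terms at strictly increasing
integer slopes, each term crossing every column cut at most `w` times (`#{i < t ≤ σ_k i} ≤ w`), has `n ≤ 2^{C (K + ⌊log₂ m⌋²)}`.
[folklore: Gusfield 1980] -/
theorem tropicalB_crossing (w : ℕ) : ∃ C : ℕ, ∀ (m K : ℕ) (d : Fin K → ℕ) (v ε : Fin m → Fin m → Fin K → ℤ) (n : ℕ)
    (θ : Fin (n + 1) → ℤ) (p : Fin (n + 1) → Equiv.Perm (Fin m) × (Fin m → Fin K)),
    (∀ (k : Fin (n + 1)) (t : ℕ),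
      (Finset.univ.filter fun i : Fin m => (i : ℕ) < t ∧ t ≤ (((p k).1 i : Fin m) : ℕ)).card ≤ w) →
    (∀ i j l, (ε i j l).natAbs ≤ 1) → StrictMono θ →
    (∀ k, IsDominant d v ε (θ k) (p k)) → (∀ k : Fin n, termSign ε (p k.castSucc) * termSign ε (p k.succ) < 0) →
    n ≤ 2 ^ (C * (K + Nat.log 2 m ^ 2)) :=
  ⟨20 * w + 8, fun _ _ d v ε _ θ p hcross _ hθ hdom halt =>
    crossing_chain_le_two_pow w d v ε θ p hθ hdom (ne_succ_of_alternating ε p halt) hcross⟩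

open IntervalOpt in
/-- **`TropicalB` ON THE SECTOR «up-jump `≤ u` except in `≤ r` dense rows and `≤ c` dense columns»** (crux currency): for every
`u, r, c` there is `C` (`= 20(u+r+c) + 8`) such that for ALL `m, K`, every design whose present entries `(a, b)` satisfy `a ≤ b + u`
unless `a ∈ A` or `b ∈ B` (`#A ≤ r`, `#B ≤ c`) admits at most `2^{C (K + ⌊log₂ m⌋²)}` sign alternations along any chain of dominant
terms at strictly increasing integer slopes. [folklore: Gusfield 1980] -/
theorem tropicalB_upJumpOff (u r c : ℕ) : ∃ C : ℕ, ∀ (m K : ℕ) (d : Fin K → ℕ) (v ε : Fin m → Fin m → Fin K → ℤ)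
    (A B : Finset (Fin m)) (n : ℕ) (θ : Fin (n + 1) → ℤ) (p : Fin (n + 1) → Equiv.Perm (Fin m) × (Fin m → Fin K)),
    A.card ≤ r → B.card ≤ c →
    (∀ (a b : Fin m) (l : Fin K), ε a b l ≠ 0 → (a : ℕ) ≤ (b : ℕ) + u ∨ a ∈ A ∨ b ∈ B) →
    (∀ i j l, (ε i j l).natAbs ≤ 1) → StrictMono θ →
    (∀ k, IsDominant d v ε (θ k) (p k)) → (∀ k : Fin n, termSign ε (p k.castSucc) * termSign ε (p k.succ) < 0) →
    n ≤ 2 ^ (C * (K + Nat.log 2 m ^ 2)) := by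
  refine ⟨20 * (u + r + c) + 8, fun m K d v ε A B n θ p hA hB hU _ hθ hdom halt => ?_⟩
  have h := designRowD_upJumpOff u A B d v ε hU n θ p hθ hdom (ne_succ_of_alternating ε p halt)
  refine h.trans (Nat.pow_le_pow_right (by norm_num) (Nat.mul_le_mul_right _ ?_))
  omega

end Summit.ValiantsHypothesis.ValiantsHypothesis.Theorems.KPlusLogSqLaw
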